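import Summits.QuantumFields.YangMills.Theorems.BalabanUVNodesN15KingModelPotentialLetters

/-!
# Route «BalabanUVNodes» (K4 «SpineRates»), node N15 = NE2 — THE KING-MODEL RUNG, part 8c: `NE2PlusUnit` BY NAME WITH A LIVE POTENTIAL, THE
# LETTERS DERIVED — the background sort of POTENTIAL TOWERS whose (3.35)∕(3.36) slots are the SIZE and the block-spin COHERENCE of the potential,
# the dressed King family on King-admissible volumes, the socket fired, and Lipschitz dependence of the dressed covariance on the potential

Cell `pub-ymgap`, Track A (D-0062), seat `pub-ymgap-dag-n15-d` (R134 seat, strategy s3, gen 6).  `bears_on: R4∕N15`; `--supports` the K3′ item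
`SpineGivenEndpointR12` (stmt-QuantumFields-19908).  COUNT-NEUTRAL; definition lane (one background sort, one index, two geometries, one pairing, one
instance family, the dressed kernel ∕ distance and the block lift are data; every theorem is by-name plumbing of parts 3, 6a, 6b, 8a, 8b).

WHY THIS FILE.  Part 6b's `ne2PlusUnit_kingE` fires the unit-layer socket with the background block LIVE, but its background sort `kingBg` DEFINES the
(3.35)∕(3.36) slots to BE the locality ∕ two-spacing letters of the perturbation («a READING … asserted by nobody»).  Here the perturbation is the FIRST
VARIATION of King's effective Laplacian along a potential tower (part 8a `potTower`), its two letters are THEOREMS (part 8b `potTower_letters_kingU`), and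
the slots become honest regularity data OF THE BACKGROUND:
§7 **the sort `potBg L s U`** — configurations = potential towers `v = (v_N)_N` (a potential on the fine torus `Π ℤ∕(N·U_μ)` for every fine count `N`;
the run with `L^k` fine points per unit side reads `v_{L^k}`), trivial background `0`, composition `+`; **(3.35) at `(c₃₅, α₀)` := SIZE**
`sup_{N,x}|v_N(x)| ≤ c₃₅α₀`; **(3.36) at `(c₃₅, α₀)` := COHERENCE across one block-spin step** `sup_{x′}|v_{L·L^k}(x′) − v_{L^k}(x under x′)| ≤ c₃₅α₀·s^k`
(`k ≥ 1`; for potentials sampled from one function on the physical torus this is β-Hölder regularity with `s = L^{−β}` — a regularity condition on the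
lattice scale, as (3.35)–(3.36) are); inhabitants beyond `0`: constants (`potBg_reg_const`) and the BLOCK LIFT `v_N = W ∘ B_N` of any unit-lattice field
`W` (`potBg_reg_blockLift`: zero coherence defect, genuinely site-dependent); the index `KingPotIdx` (volume exponent `e`, `k ≥ 1`, shift `n ≥ 1`, free
size letter `Msz ≥ 1`), part 1's realised King geometries over the King-admissible torus `kingU d L e` (`kingGeoCV`∕`kingGeoFV`), the identity pairing
`kingPairingV`, the family **`kingInstanceV L s`**, the dressed unit kernel **`kingKerV`** `(v, y, y′) ↦ C_{E(v)}^{(k+1)}(y,y′) − C_{E(v)}^{(k)}(y,y′)`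
(part 6b's `kingCovE` at the tower `potTower v`; `kingCovE_potTower_zero`: undressed at `v = 0`), `kingDistV = |·|_T`.
§8 `kingLeaves_at` (part 3's five leaves of the free tower at any Combes–Thomas rate `0 < κ ≤ κ′` and ratio `r ≥ L⁻²`, volume sum `K_{d+1}(κ∕2)`),
`rate_facts` (`0 < L^{−1∕2} < 1`, `L⁻² ≤ L^{−1∕2}`), and **`ne2PlusUnit_kingV`**: for odd `L ≥ 3`, `a, m² > 0`, EVERY `c₃₅ > 0` and EVERY coherence rate
`0 ≤ s ≤ L^{−1∕2}`, `NE2PlusUnit c35 (kingInstanceV L s) (kingKerV L a m² s) ⊤ tdistT` — part 6a's `ne2PlusUnit_of_freeLeaves_add` on part 3's free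
leaves at the rate `κ₈ = min(κ′, κ₁)` the DERIVED locality allows, window `a₀ = γ₀∕(8K(κ₈∕2)c₁c₃₅)` keeping the gap `ρ + ρ_B + 2c_EV < γ₀`, constants
uniform in the index AND the potential, rate `θ = L^{−1∕4}`; `ne2ZeroUnit_kingV`; **`kingCovE_potTower_lipschitz`** — `∃ κ Λ a₁ > 0`:
`|(Δ^{(j)} + aL⁻²Q*Q)⁻¹(x,y) − C_{E(v)}^{(j)}(x,y)| ≤ w₀·Λ·e^{−κ|x−y|}` at EVERY level for every potential tower of size `≤ w₀ ≤ a₁` (part 6a's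
`inv_sub_inv_perturbed_le` = King's (4.39)–(4.41) at one level, on the derived locality; no coherence needed).

HONEST FRAMING ∕ LIMITS.  King's `A = 0` SCALAR tower (periodic b.c., flat blocks, `m² > 0`, odd `L ≥ 3`, volumes `2L^{e+1}`, levels `k ≥ 1`) dressed TO
FIRST ORDER by a scalar potential: the dressed operator is `Δ^{(k)} + δΔ^{(k)}[v]`, NOT the full `Δ^{(k)}_v` (second-order remainder not constructed),
and a potential is NOT a gauge field — nothing here is Bałaban's `Δ^{(k)}(U) − Δ^{(k)}(1)`, `C^{(k)}(Λ; U)`, `G(U)` (η-differences NOT PRINTED: [B9]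
prints η-uniformity and analyticity, Thm 3.4); the (3.35)∕(3.36) slots are OUR reading for this model (size ∕ coherence), the complex sorts inert; no
`def … : Prop` is a hypothesis of anything but the socket's own window; NOT the carriers of record (NODE 00); NOT a node discharge; typed 28∕28,
discharged count untouched; one finite torus programme at fixed ε — NOT ℝ⁴ ∕ infinite volume ∕ OS ∕ mass gap ∕ Clay.  Locators only: [King1986] CMP
**102** (1986): (2.13)–(2.15) p. 653, Theorem 3.3 (3.7) p. 658, p. 664, Prop. 3.8 (3.71) p. 664, Lemma 4.3 (4.18) p. 672, (4.32)–(4.34), (4.38), (4.39)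
p. 674, (4.40)–(4.41) p. 675; [B9] = [Balaban1985BackgroundPropagators] CMP **99** (1985) (3.35)–(3.36) p. 396, Thm 3.4 p. 400, Thm 3.14–3.15
pp. 426–432 (templates).
-/

noncomputable section

open scoped BigOperators
open Finset

namespace Summit.QuantumFields.YangMills.BalabanUVNodes.N15.KingModel

open Literature.MathematicalPhysics.QuantumFieldTheory.Balaban1983to89 hiding blockOf
open Literature.MathematicalPhysics.QuantumFieldTheory.Balaban1983to89.T4EtaRate (PairedInstance EtaPairing NE2PlusUnit)
open Literature.MathematicalPhysics.QuantumFieldTheory.Balaban1983to89.T4EtaRateUnitWitness (NE2ZeroUnit ne2ZeroUnit_of_ne2PlusUnit)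
open Literature.MathematicalPhysics.QuantumFieldTheory.Balaban1983to89.B4Sect5Proof (latticeConst latticeConst_nonneg)
open Literature.MathematicalPhysics.QuantumFieldTheory.Balaban1983to89.B5Prop11Plancherel (Tor fine)
open Literature.MathematicalPhysics.QuantumFieldTheory.King1986.Torus (blockOf tdistT tdistT_isPseudoDist tdistT_sumBound aminL aminL_pos CDelU
  CDelU_pos gam0L gam0L_pos kapCT kapCT_pos_le thetaBar)
open Summit.QuantumFields.BalabanUV.T4Continuum.NE2KingTransplant (IsPseudoMetric UniformCoercive UniformCTBound UniformKernelDecay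
  EffectiveOperatorSupRate VolumeSum)
open Summit.QuantumFields.YangMills.BalabanUVNodes.N15KingModelRung.Curved (underPtN blockOf_underPtN)

variable {d : ℕ}

/-! ## §7 The background sort of POTENTIAL TOWERS with honest regularity slots, the dressed King family, and `NE2PlusUnit` BY NAME -/

section PotSort

variable (L : ℕ) [NeZero L]

/-- **THE BACKGROUND SORT OF POTENTIAL TOWERS** over the unit torus `Π ℤ∕U_μ`: a configuration is a potential `v_N` on the fine torus `Π ℤ∕(N·U_μ)`
for every fine count `N` (the run with `L^k` fine points per unit side reads `v_{L^k}`); trivial background = the zero tower; composition = addition;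
**(3.35) at `(c₃₅, α₀)` := the SIZE letter** `sup_{N,x} |v_N(x)| ≤ c₃₅α₀` (small field); **(3.36) at `(c₃₅, α₀)` := the COHERENCE letter**
`sup_{x′} |v_{L·L^k}(x′) − v_{L^k}(x under x′)| ≤ c₃₅α₀·s^k` for `k ≥ 1` — the two runs' potentials agree across one block-spin step at the
geometric rate `s` (for potentials sampled from one function `W` on the physical torus, `v_N(x) = W(x∕N)`, this is β-Hölder regularity of `W` with
`s = L^{−β}`: the discrete form of a regularity condition ON THE LATTICE SCALE, as (3.35)–(3.36) are); complex-extension sorts inert.  HONEST SCOPE: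
scalar potentials, NOT gauge fields; the slots are OUR reading for this model. [cite: Balaban1985BackgroundPropagators, (3.35)–(3.36) p.396 (the two regularity slots: typing template)] -/
@[reducible] def potBg (s : ℝ) (U : Fin (d + 1) → ℕ) : B9.Backgrounds where
  Cfg := ∀ N : ℕ, Tor (fine N U) → ℝ
  one := fun _ _ => 0
  mul := fun v v' N x => v N x + v' N x
  Reg335 := fun c35 α₀ v => ∀ (N : ℕ) (x : Tor (fine N U)), |v N x| ≤ c35 * α₀
  Reg336 := fun c35 α₀ v => ∀ (k : ℕ), 1 ≤ k → ∀ x' : Tor (fine (L ^ 1 * L ^ k) U),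
    |v (L ^ 1 * L ^ k) x' - v (L ^ k) (underPtN L k 1 U x')| ≤ c35 * α₀ * s ^ k
  Cplx337 := fun _ _ _ => True
  Cplx338 := fun _ _ _ => True

omit [NeZero L] in
/-- THE SORT IS POPULATED BEYOND THE TRIVIAL TOWER, I: a CONSTANT potential `v_N ≡ t` is (3.35)∧(3.36)-regular at every size `c₃₅α₀ ≥ |t|`
(`s ≥ 0`; zero coherence defect). [folklore] -/
theorem potBg_reg_const {s : ℝ} (hs : 0 ≤ s) (U : Fin (d + 1) → ℕ) {t c35 α₀ : ℝ} (ht : |t| ≤ c35 * α₀) :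
    (potBg (d := d) L s U).Reg335 c35 α₀ (fun _ _ => t) ∧ (potBg (d := d) L s U).Reg336 c35 α₀ (fun _ _ => t) := by
  refine ⟨fun N x => ht, fun k hk x' => ?_⟩
  show |t - t| ≤ c35 * α₀ * s ^ k
  rw [sub_self, abs_zero]
  exact mul_nonneg ((abs_nonneg t).trans ht) (pow_nonneg hs k)

/-- THE BLOCK LIFT of a unit-lattice field `W`: the potential tower `v_N(x) = W(B_N(x))` (constant on unit blocks at every fine count; `0` at the
degenerate count `N = 0`). [folklore] -/
def blockLift (U : Fin (d + 1) → ℕ) [∀ μ, NeZero (U μ)] (W : Tor U → ℝ) : ∀ N : ℕ, Tor (fine N U) → ℝ :=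
  fun N x => if h : N = 0 then 0 else W (@blockOf _ N ⟨h⟩ U _ x)

/-- At a genuine fine count the block lift reads `W` on the block. [folklore] -/
theorem blockLift_apply (U : Fin (d + 1) → ℕ) [∀ μ, NeZero (U μ)] (W : Tor U → ℝ) (N : ℕ) [NeZero N] (x : Tor (fine N U)) :
    blockLift U W N x = W (blockOf N U x) := by
  simp only [blockLift, dif_neg (NeZero.ne N)]

/-- THE SORT IS POPULATED, II (site-dependent): the block lift of ANY unit-lattice field `W` with `sup|W| ≤ c₃₅α₀` is (3.35)∧(3.36)-regular with
ZERO coherence defect (the point under `x′` lies in the same unit block, `blockOf_underPtN`) — the window of `ne2PlusUnit_kingV` below contains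
genuinely site-dependent backgrounds. [folklore] -/
theorem potBg_reg_blockLift {s : ℝ} (hs : 0 ≤ s) (U : Fin (d + 1) → ℕ) [∀ μ, NeZero (U μ)] (W : Tor U → ℝ) {c35 α₀ : ℝ}
    (hW : ∀ z, |W z| ≤ c35 * α₀) :
    (potBg (d := d) L s U).Reg335 c35 α₀ (blockLift U W) ∧ (potBg (d := d) L s U).Reg336 c35 α₀ (blockLift U W) := by
  refine ⟨fun N x => ?_, fun k hk x' => ?_⟩
  · show |blockLift U W N x| ≤ c35 * α₀
    by_cases h : N = 0
    · simp only [blockLift, dif_pos h, abs_zero]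
      exact (abs_nonneg _).trans (hW 0)
    · haveI : NeZero N := ⟨h⟩
      rw [blockLift_apply]
      exact hW _
  · show |blockLift U W (L ^ 1 * L ^ k) x' - blockLift U W (L ^ k) (underPtN L k 1 U x')| ≤ c35 * α₀ * s ^ k
    rw [blockLift_apply, blockLift_apply, blockOf_underPtN, sub_self, abs_zero]
    exact mul_nonneg ((abs_nonneg _).trans (hW 0)) (pow_nonneg hs k)

/-- THE INDEX OF THE DRESSED KING FAMILY ON KING-ADMISSIBLE VOLUMES: volume exponent `e` (unit torus `Π ℤ∕(2L^{e+1})`), the coarse run's number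
of scales `k ≥ 1`, the scale shift `n ≥ 1`, and [B9]'s size letter `Msz ≥ 1` (free, as in part 1's `KingIndex`). [cite: King1986, Lemma 4.5 (4.38) p.674 (quantifiers k, n ≥ 1)] -/
structure KingPotIdx (d : ℕ) where
  /-- volume exponent -/
  e : ℕ
  /-- number of scales of the coarse run -/
  k : ℕ
  one_le_k : 1 ≤ k
  /-- scale shift -/
  n : ℕ
  one_le_n : 1 ≤ n
  /-- the [B9] size letter -/
  Msz : ℝ
  one_le_Msz : 1 ≤ Msz

/-- The index type is inhabited. [folklore] -/
theorem kingPotIdx_nonempty (d : ℕ) : Nonempty (KingPotIdx d) := ⟨⟨0, 1, le_rfl, 1, le_rfl, 1, le_rfl⟩⟩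

/-- THE COARSE [B9] GEOMETRY at an index: part 1's realised King carrier over the King-admissible unit torus at level `k`. [cite: Balaban1985BackgroundPropagators, (3.42) p.397 (typing template)] -/
@[reducible] def kingGeoCV (i : KingPotIdx d) : B9.Geometry :=
  OperatorReadout.opGeo (kingGeo L i.k (kingU d L i.e) i.Msz) (Tor (kingU d L i.e)) (fun x => x)

/-- THE FINE [B9] GEOMETRY at an index (level `k + n`, same unit torus). [cite: Balaban1985BackgroundPropagators, (3.42) p.397 (typing template)] -/
@[reducible] def kingGeoFV (i : KingPotIdx d) : B9.Geometry :=
  OperatorReadout.opGeo (kingGeo L (i.k + i.n) (kingU d L i.e) i.Msz) (Tor (kingU d L i.e)) (fun x => x)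

/-- THE η-PAIRING with the potential sort live: identity on sites and arguments, scale shift `n`, background transport `avg` = the identity (a
potential tower carries every fine count; the coarse run reads the coarser members). [cite: King1986, p.664 (convention before Prop. 3.8)] -/
def kingPairingV (s : ℝ) (i : KingPotIdx d) :
    EtaPairing (kingGeoCV L i) (kingGeoFV L i) (potBg L s (kingU d L i.e)) (potBg L s (kingU d L i.e)) where
  n := i.n
  k_eq := rfl
  L_eq := rfl
  M_eq := rfl
  eta_eq := by
    have hL0 : (L : ℝ) ≠ 0 := Nat.cast_ne_zero.mpr (NeZero.ne L)
    show (((L : ℝ) ^ (i.k + i.n)))⁻¹ * (L : ℝ) ^ i.n = (((L : ℝ) ^ i.k))⁻¹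
    rw [pow_add, mul_inv, mul_assoc, inv_mul_cancel₀ (pow_ne_zero _ hL0), mul_one]
  ι := fun y => y
  scale_ι := fun _ => rfl
  dist_ι := fun _ _ => rfl
  τ := fun lam => lam
  suppIn_τ := fun _ _ h => h
  supNorm_τ := fun _ => le_rfl
  avg := fun v => v
  avg_one := rfl

/-- THE DRESSED KING FAMILY WITH A LIVE POTENTIAL: realised King geometries on King-admissible volumes, the potential sort on both sides.
[cite: Balaban1985BackgroundPropagators, Thm 3.14 pp.426–427 (typing template)] -/
def kingInstanceV (s : ℝ) (i : KingPotIdx d) : PairedInstance :=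
  ⟨kingGeoCV L i, kingGeoFV L i, potBg L s (kingU d L i.e), potBg L s (kingU d L i.e), kingPairingV L s i⟩

/-- THE DRESSED UNIT KERNEL: at index `i` and potential tower `v`, `(y, y′) ↦ C_{E(v)}^{(k+1)}(y, y′) − C_{E(v)}^{(k)}(y, y′)`, the one-step
η-difference of the covariances of King's tower dressed by the first variation along `v` (part 6b's `kingCovE` at the tower `potTower v`).
[cite: King1986, Lemma 4.5 (4.38) p.674 (the differenced object, A = 0); Balaban1985BackgroundPropagators, Thm 3.15 (3.187) p.432 (C^{(k)}(Λ;U): shape)] -/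
def kingKerV (a m2 s : ℝ) (i : KingPotIdx d) : B9.SiteKernel (kingInstanceV L s i).gc (kingInstanceV L s i).Bf :=
  ⟨fun v y y' => kingCovE a m2 L (kingM d L i.e) (potTower L (kingU d L i.e) a m2 v) (i.k + 1) y y'
      - kingCovE a m2 L (kingM d L i.e) (potTower L (kingU d L i.e) a m2 v) i.k y y'⟩

/-- `unitDist :=` King's periodic unit-lattice distance. [cite: King1986, Lemma 4.5 (4.38) p.674] -/
def kingDistV (s : ℝ) : ∀ i : KingPotIdx d, (kingInstanceV L s i).gc.Site → (kingInstanceV L s i).gc.Site → ℝ :=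
  fun i y y' => tdistT (kingU d L i.e) y y'

/-- At the zero potential tower the dressed covariance is the undressed one. [folklore] -/
theorem kingCovE_potTower_zero (a m2 : ℝ) (e j : ℕ) :
    kingCovE a m2 L (kingM d L e) (potTower L (kingU d L e) a m2 (fun _ _ => 0)) j
      = (kingTower a m2 L (kingM d L e) j + kingBlock a L (kingM d L e))⁻¹ := by
  rw [show potTower L (kingU d L e) a m2 (fun _ _ => 0) = 0 from funext fun j => potTower_zero_potential j]
  exact kingCovE_zero j

end PotSort

/-! ## §8 The socket fires: part 3's free leaves at the reduced Combes–Thomas rate, the window, `NE2PlusUnit` BY NAME, Lipschitz in the potential -/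

section Socket

open Real

variable (L : ℕ) [NeZero L]

/-- **THE FIVE LEAVES OF KING'S FREE TOWER AT A REDUCED COMBES–THOMAS RATE AND A LARGER RATIO** (part 3's leaves, monotonicity): at any rate
`0 < κ ≤ κ′ = kapCT` and any ratio `L⁻² ≤ r`, the leaves hold with constants `(γ₀, κ, ρ, ρ_B, C_U, θ̄a, r, K_{d+1}(κ∕2))`. [cite: King1986, (4.33)–(4.34) p.674, Lemma 4.3 (4.18) p.672, (4.41) p.675] -/
theorem kingLeaves_at {dd : ℕ} {a m2 : ℝ} (ha : 0 < a) (hm : 0 < m2) (hL : 2 ≤ L) (M : Fin dd → ℕ) [∀ μ, NeZero (M μ)] {κ r : ℝ}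
    (hκ0 : 0 < κ) (hκ : κ ≤ kapCT dd a L) (hr : ((L : ℝ) ^ 2)⁻¹ ≤ r) :
    UniformCoercive (kingTower a m2 L M) (kingBlock a L M) (gam0L dd a L) ∧
      UniformCTBound (kingTower a m2 L M) (kingBlock a L M) (tdistT (fine L M)) κ (kingRho dd a L) (kingRhoB dd a L) ∧
      UniformKernelDecay (kingTower a m2 L M) (tdistT (fine L M)) (CDelU dd a (aminL a L)) κ ∧
      EffectiveOperatorSupRate (kingTower a m2 L M) (thetaBar a L * a) r ∧
      VolumeSum (tdistT (fine L M)) κ (latticeConst dd (κ / 2)) := by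
  have hpd := tdistT_isPseudoDist (fine L M)
  refine ⟨uniformCoercive_kingTower ha hm hL, uniformCTBound_mono_rate hκ hpd.nonneg (uniformCTBound_kingTower ha hm hL),
    uniformKernelDecay_mono_rate (CDelU_pos (d := dd) ha (aminL_pos ha hL)).le hκ hpd.nonneg (uniformKernelDecay_kingTower ha hm hL),
    effectiveOperatorSupRate_mono_rate (thetaBar_mul_nonneg ha hL) (by positivity) hr (effectiveOperatorSupRate_kingTower ha hm hL),
    fun x => tdistT_sumBound (fine L M) (κ / 2) (half_pos hκ0) x⟩

omit [NeZero L] in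
/-- `L⁻² ≤ L^{−1∕2} < 1` and `0 < L^{−1∕2}` for `L ≥ 2`. [folklore] -/
theorem rate_facts (hL : 2 ≤ L) :
    0 < (L : ℝ) ^ (-(1 / 2 : ℝ)) ∧ (L : ℝ) ^ (-(1 / 2 : ℝ)) < 1 ∧ ((L : ℝ) ^ 2)⁻¹ ≤ (L : ℝ) ^ (-(1 / 2 : ℝ)) := by
  have hLr : (1 : ℝ) < L := by exact_mod_cast (by omega : 1 < L)
  have hL0 : (0 : ℝ) < L := by positivity
  refine ⟨rpow_pos_of_pos hL0 _, rpow_lt_one_of_one_lt_of_neg hLr (by norm_num), ?_⟩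
  rw [← rpow_natCast, ← rpow_neg hL0.le]
  exact rpow_le_rpow_of_exponent_le hLr.le (by norm_num)

/-- **THE SOCKET FIRES WITH A LIVE POTENTIAL — `NE2PlusUnit` BY NAME, THE LETTERS DERIVED** (torus dimension `d + 1`, odd `L ≥ 3`, `a, m² > 0`,
every `c₃₅ > 0`, every coherence rate `0 ≤ s ≤ L^{−1∕2}`): on the dressed family `kingInstanceV L s` (index = volume exponent, `k ≥ 1`, shift, free
size letter `Msz ≥ 1`; backgrounds = POTENTIAL TOWERS with (3.35) := size, (3.36) := coherence at rate `s`) with the dressed one-step unit kernel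
`kingKerV` (King's covariance dressed by the first variation along the potential), `inΛ := ⊤`, `unitDist := |·|_T`:
`NE2PlusUnit c35 (kingInstanceV L s) (kingKerV L a m² s) ⊤ tdistT`.  Mechanism: part 8b's two letters (THEOREMS from King's printed minimiser decay and
Prop. 3.8 step) at size `c₃₅α₀` and coherence `c₃₅α₀·s^k`; part 3's free leaves at the reduced Combes–Thomas rate `κ₈ = min(κ′, κ₁)` and ratio
`L^{−1∕2}` (`kingLeaves_at`); the window `a₀ := γ₀∕(8·K(κ₈∕2)·c₁·c₃₅)` keeps the gap `ρ + ρ_B + 2c_EV < γ₀`; part 6a's socket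
`ne2PlusUnit_of_freeLeaves_add`.  Constants `(δ₀, a₀, B₀, θ)` uniform in the index AND the potential; `θ = L^{−1∕4}`.  HONEST SCOPE: King's `A = 0`
scalar tower dressed TO FIRST ORDER by a scalar potential (the dressed operator is `Δ^{(k)} + δΔ^{(k)}[v]`, NOT the full `Δ^{(k)}_v`); NOT Bałaban's
`C^{(k)}(Λ; U)` nor a gauge-field background; NOT a node discharge; count-neutral. [cite: King1986, Lemma 4.5 (4.38) p.674 with (4.33)–(4.34), Theorem 3.3 (3.7) p.658, Prop. 3.8 (3.71) p.664, Lemma 4.3 (4.18) p.672, (4.39) p.674, (4.40)–(4.41) p.675; Balaban1985BackgroundPropagators, Thm 3.15 (3.187) p.432 (quantifier template), (3.35)–(3.36) p.396 (slots)] -/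
theorem ne2PlusUnit_kingV (hLodd : Odd L) (hL : 2 ≤ L) {a m2 : ℝ} (ha : 0 < a) (hm : 0 < m2) {c35 : ℝ} (hc : 0 < c35)
    {s : ℝ} (hs0 : 0 ≤ s) (hs1 : s ≤ (L : ℝ) ^ (-(1 / 2 : ℝ))) :
    NE2PlusUnit c35 (kingInstanceV (d := d) L s) (kingKerV L a m2 s) (fun _ _ => True) (kingDistV L s) := by
  obtain ⟨κ₁, c₁, hκ₁, hc₁, HL⟩ := potTower_letters_kingU (d := d) L hLodd hL ha hm
  obtain ⟨hr0, hr1, hr2⟩ := rate_facts L hL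
  have hamin := aminL_pos ha hL
  have hγ := gam0L_pos (d := d + 1) ha hL
  have hθ := thetaBar_mul_nonneg (a := a) ha hL
  have hCU := CDelU_pos (d := d + 1) ha hamin
  obtain ⟨hκ'0, -⟩ := kapCT_pos_le (d := d + 1) ha hL
  set κ₈ : ℝ := min (kapCT (d + 1) a L) κ₁ with hκ₈
  have hκ₈0 : 0 < κ₈ := lt_min hκ'0 hκ₁
  have hκ₈1 : κ₈ ≤ kapCT (d + 1) a L := min_le_left _ _
  have hκ₈2 : κ₈ ≤ κ₁ := min_le_right _ _
  set V₈ : ℝ := latticeConst (d + 1) (κ₈ / 2) with hV₈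
  have hV : 0 < V₈ := latticeConst_pos (d + 1) (half_pos hκ₈0)
  set γ₀ : ℝ := gam0L (d + 1) a L with hγ₀
  have hρ := kingRho_add_le (dd := d + 1) ha hL
  refine ne2PlusUnit_of_freeLeaves_add (c35 := c35) (pi := kingInstanceV (d := d) L s) (Kd := kingKerV L a m2 s)
    (inΛ := fun _ _ => True) (unitDist := kingDistV L s) (m := fun i => Tor (kingU d L i.e)) (a₀ := γ₀ / (8 * V₈ * c₁ * c35))
    (by positivity) (fun _ y => y) (fun i => tdistT (kingU d L i.e)) (fun i => kingTower a m2 L (kingM d L i.e))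
    (fun i v => potTower L (kingU d L i.e) a m2 v) (fun i => kingBlock a L (kingM d L i.e))
    (γ := γ₀) (κ := κ₈) (ρ := kingRho (d + 1) a L) (ρB := kingRhoB (d + 1) a L) (ε := thetaBar a L * a)
    (C₁ := CDelU (d + 1) a (aminL a L)) (V := V₈) (r := (L : ℝ) ^ (-(1 / 2 : ℝ))) (cE := γ₀ / (8 * V₈)) (εE := γ₀ / (4 * V₈))
    ?_ hκ₈0 (by positivity) (by positivity) (by positivity) hV hr0 hr1 (fun i => isPseudoMetric_tdistT (kingU d L i.e)) (fun _ _ _ => le_rfl)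
    (fun i => kingLeaves_at L ha hm hL (kingM d L i.e) hκ₈0 hκ₈1 hr2) fun i α₀ hα hMa v h335 h336 => ?_
  · -- the gap `ρ + ρ_B + 2c_EV < γ₀`
    have e1 : 2 * (γ₀ / (8 * V₈) * V₈) = γ₀ / 4 := by field_simp; ring
    rw [e1]
    linarith
  · -- the letters at a regular potential inside the window
    have hcα : 0 ≤ c35 * α₀ := by positivity
    have hα : c35 * α₀ ≤ γ₀ / (8 * V₈ * c₁) := by
      have h1 : α₀ ≤ i.Msz * α₀ := le_mul_of_one_le_left hα.le i.one_le_Msz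
      have h2 : α₀ ≤ γ₀ / (8 * V₈ * c₁ * c35) := h1.trans hMa
      rw [le_div_iff₀ (by positivity)] at h2
      rw [le_div_iff₀ (by positivity)]
      linarith
    obtain ⟨l1, l2'⟩ := HL i.e v (c35 * α₀) h335
    have l2 := l2' (c35 * α₀) s hcα hs0 hs1 h336
    refine ⟨?_, ?_, fun y y' => rfl⟩
    · have hcE : c35 * α₀ * c₁ ≤ γ₀ / (8 * V₈) := by
        rw [le_div_iff₀ (by positivity)] at hα ⊢
        nlinarith
      exact uniformKernelDecay_mono
        (uniformKernelDecay_mono_rate (by positivity) hκ₈2 (tdistT_isPseudoDist (kingU d L i.e)).nonneg l1) hcE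
    · have hεE : c₁ * (c35 * α₀ + c35 * α₀) ≤ γ₀ / (4 * V₈) := by
        rw [le_div_iff₀ (by positivity)] at hα ⊢
        nlinarith
      exact effectiveOperatorSupRate_mono hr0.le l2 hεE

/-- … and the trivial-background unit layer `NE2ZeroUnit` of the family (the zero tower is regular at every size). [cite: King1986, Lemma 4.5 (4.38) p.674] -/
theorem ne2ZeroUnit_kingV (hLodd : Odd L) (hL : 2 ≤ L) {a m2 : ℝ} (ha : 0 < a) (hm : 0 < m2) {s : ℝ} (hs0 : 0 ≤ s)
    (hs1 : s ≤ (L : ℝ) ^ (-(1 / 2 : ℝ))) :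
    NE2ZeroUnit (kingInstanceV (d := d) L s) (kingKerV L a m2 s) (fun _ _ => True) (kingDistV L s) := by
  refine ne2ZeroUnit_of_ne2PlusUnit (c35 := 1) (fun i => lt_of_lt_of_le one_pos i.one_le_Msz) (fun i α₀ hα => ?_) (fun i α₀ hα => ?_)
    (ne2PlusUnit_kingV L hLodd hL ha hm one_pos hs0 hs1)
  · exact (potBg_reg_const L hs0 (kingU d L i.e) (t := 0) (by rw [abs_zero]; positivity)).1
  · exact (potBg_reg_const L hs0 (kingU d L i.e) (t := 0) (by rw [abs_zero]; positivity)).2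

/-- **THE DRESSED COVARIANCE IS LIPSCHITZ IN THE SIZE OF THE POTENTIAL, UNIFORMLY IN THE LEVEL AND THE VOLUME, WITH DECAY** (part 6a's
`inv_sub_inv_perturbed_le` = King's (4.39)–(4.41) at one level, on part 8b's locality letter): there are `κ, Λ, a₁ > 0` with
`|(Δ^{(j)} + aL⁻²Q*Q)⁻¹(x, y) − C_{E(v)}^{(j)}(x, y)| ≤ w₀·Λ·e^{−κ|x − y|}` at EVERY level `j` for every potential tower of size `sup|v_N| ≤ w₀ ≤ a₁`
(no coherence needed). [cite: King1986, (4.39) p.674, (4.40)–(4.41) p.675 (the mechanism, A = 0)] -/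
theorem kingCovE_potTower_lipschitz (hLodd : Odd L) (hL : 2 ≤ L) {a m2 : ℝ} (ha : 0 < a) (hm : 0 < m2) :
    ∃ κ Λ a₁ : ℝ, 0 < κ ∧ 0 < Λ ∧ 0 < a₁ ∧ ∀ (e : ℕ) (v : ∀ N : ℕ, Tor (fine N (kingU d L e)) → ℝ) (w₀ : ℝ),
      (∀ (N : ℕ) (x : Tor (fine N (kingU d L e))), |v N x| ≤ w₀) → w₀ ≤ a₁ →
      ∀ (j : ℕ) (x y : Tor (kingU d L e)),
        |(kingTower a m2 L (kingM d L e) j + kingBlock a L (kingM d L e))⁻¹ x y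
            - kingCovE a m2 L (kingM d L e) (potTower L (kingU d L e) a m2 v) j x y|
          ≤ w₀ * Λ * Real.exp (-(κ * tdistT (kingU d L e) x y)) := by
  obtain ⟨κ₁, c₁, hκ₁, hc₁, HL⟩ := potTower_letters_kingU (d := d) L hLodd hL ha hm
  obtain ⟨hr0, -, hr2⟩ := rate_facts L hL
  have hγ := gam0L_pos (d := d + 1) ha hL
  obtain ⟨hκ'0, -⟩ := kapCT_pos_le (d := d + 1) ha hL
  set κ₈ : ℝ := min (kapCT (d + 1) a L) κ₁ with hκ₈
  have hκ₈0 : 0 < κ₈ := lt_min hκ'0 hκ₁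
  set V₈ : ℝ := latticeConst (d + 1) (κ₈ / 2) with hV₈
  have hV : 0 < V₈ := latticeConst_pos (d + 1) (half_pos hκ₈0)
  set γ₀ : ℝ := gam0L (d + 1) a L with hγ₀
  have hρ := kingRho_add_le (dd := d + 1) ha hL
  refine ⟨κ₈ / 2, c₁ * (4 / γ₀) ^ 2 * V₈ ^ 2, γ₀ / (8 * V₈ * c₁), half_pos hκ₈0, by positivity, by positivity,
    fun e v w₀ hsize hw j x y => ?_⟩
  have hw0 : 0 ≤ w₀ := (abs_nonneg _).trans (hsize 1 (fun μ => 0))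
  have hpd := tdistT_isPseudoDist (kingU d L e)
  obtain ⟨g1, g2, -, -, g4⟩ := kingLeaves_at L ha hm hL (kingM d L e) hκ₈0 (min_le_left _ _) hr2
  obtain ⟨l1, -⟩ := HL e v w₀ hsize
  have hκ₈2 : κ₈ ≤ κ₁ := min_le_right _ _
  have l1' := uniformKernelDecay_mono_rate (by positivity : 0 ≤ w₀ * c₁) hκ₈2 hpd.nonneg l1
  have hwV : w₀ * c₁ * V₈ ≤ γ₀ / 8 := by
    rw [le_div_iff₀ (by positivity)] at hw
    rw [le_div_iff₀ (by norm_num : (0 : ℝ) < 8)]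
    nlinarith
  have hgap : kingRho (d + 1) a L + kingRhoB (d + 1) a L + 2 * (w₀ * c₁ * V₈) < γ₀ := by linarith
  have h := inv_sub_inv_perturbed_le (E := potTower L (kingU d L e) a m2 v) (isPseudoMetric_tdistT (kingU d L e)) hκ₈0.le
    (by positivity) hgap g1 g2 g4 l1' j x y
  have hmar : γ₀ / 4 ≤ γ₀ - w₀ * c₁ * V₈ - (kingRho (d + 1) a L + w₀ * c₁ * V₈ + kingRhoB (d + 1) a L) := by linarith
  have hinv : (γ₀ - w₀ * c₁ * V₈ - (kingRho (d + 1) a L + w₀ * c₁ * V₈ + kingRhoB (d + 1) a L))⁻¹ ≤ 4 / γ₀ := by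
    rw [div_eq_mul_inv, show (4 : ℝ) * γ₀⁻¹ = (γ₀ / 4)⁻¹ by rw [inv_div]; ring]
    exact inv_anti₀ (by positivity) hmar
  have hinv2 : (γ₀ - w₀ * c₁ * V₈ - (kingRho (d + 1) a L + w₀ * c₁ * V₈ + kingRhoB (d + 1) a L))⁻¹ ^ 2 ≤ (4 / γ₀) ^ 2 :=
    pow_le_pow_left₀ (inv_nonneg.mpr (by linarith)) hinv 2
  calc |(kingTower a m2 L (kingM d L e) j + kingBlock a L (kingM d L e))⁻¹ x y
          - kingCovE a m2 L (kingM d L e) (potTower L (kingU d L e) a m2 v) j x y|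
      = |(kingTower a m2 L (kingM d L e) j + kingBlock a L (kingM d L e))⁻¹ x y
          - (kingTower a m2 L (kingM d L e) j + potTower L (kingU d L e) a m2 v j + kingBlock a L (kingM d L e))⁻¹ x y| := rfl
    _ ≤ w₀ * c₁ * (γ₀ - w₀ * c₁ * V₈ - (kingRho (d + 1) a L + w₀ * c₁ * V₈ + kingRhoB (d + 1) a L))⁻¹ ^ 2 * V₈ ^ 2
          * Real.exp (-(κ₈ / 2 * tdistT (kingU d L e) x y)) := h
    _ ≤ w₀ * c₁ * (4 / γ₀) ^ 2 * V₈ ^ 2 * Real.exp (-(κ₈ / 2 * tdistT (kingU d L e) x y)) := by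
        gcongr
    _ = w₀ * (c₁ * (4 / γ₀) ^ 2 * V₈ ^ 2) * Real.exp (-(κ₈ / 2 * tdistT (kingU d L e) x y)) := by ring

end Socket

end Summit.QuantumFields.YangMills.BalabanUVNodes.N15.KingModel

end
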